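import Summits.FinalStateConjecture.FinalStateConjecture.Theorems.PhotonSphereChannelsChannelsResolveTameDevelopmentsRMorawetzIdentity
import Summits.FinalStateConjecture.FinalStateConjecture.Theorems.PhotonSphereChannelsChannelsResolveTameDevelopmentsRMorawetzWeight
import Summits.FinalStateConjecture.FinalStateConjecture.Theorems.PhotonSphereChannelsChannelsResolveTameDevelopmentsRLocalEnergyTools

/-!
# Route PhotonSphereChannels — integrated local energy decay (Morawetz estimate) for every fixed
# Regge–Wheeler mode, compactly supported data

The registered sub-goal `stub_rwLocalEnergyDecay` (ILED) of stub `stub_outgoingEnergyExhaustion` (H4) of line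
`isolated-kerr-connected-hull` (crux stmt-FinalStateConjecture-14075): for a tortoise radius function with the
photon sphere at `xc`, `s ≤ 2`, `s ≤ ℓ` and every `ρ > 0` there is `C = C(M, s, ℓ, ρ)` such that every global `C²`
solution of `ψ_tt − ψ_xx + V_{s,ℓ}(r)ψ = 0` with compactly supported Cauchy data obeys
`∫_0^T ∫_{xc−ρ}^{xc+ρ} (ψ_t² + ψ_x² + ψ²) dx dt ≤ C · E` for all `T ≥ 0` (`E` the conserved total energy).

Proof (`RW.rwLocalEnergyDecay_fderiv`; tools in `…RLocalEnergyTools`): apply the multiplier identity of `…RMorawetzIdentity` on the rectangle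
`[0, T] × [X_L, X_R]` whose lateral sides lie outside the light cone of the data (there `ψ, ψ_t, ψ_x` vanish by
finite speed of propagation, so the lateral flux is zero) to the current
`c`·(coercive Morawetz weights of `…RMorawetzWeight`, `β = ½ f′`) + (Lagrangian current `β = −h`, `φ = 0` of a
`C¹` bump `h = 1` on `[xc−ρ, xc+ρ]`, supported in `K' = [xc−ρ−1, xc+ρ+1]`).  Its bulk is
`c·B₀ + h ψ_t² − h ψ_x² − h′ψψ_x − hVψ²` with `B₀ ≥ m(x)(ψ_x² + ψ²)`; with `m ≥ m₁ > 0`, `|h′| ≤ H`, `V ≤ V_b` on `K'`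
(compactness) and `c = (N+1)/m₁`, `N = 1 + H + V_b`, the bulk dominates `h ψ_t² + (m/m₁)(ψ_x² + ψ²) ≥ 0`, which is
`≥ ψ_t² + ψ_x² + ψ²` on the strip; the time-slice terms are `≤ (c + 1 + 1/V_min) E` (`|f| ≤ 1`, `f′² ≤ (9/16)V`,
`V ≥ V_min > 0` on `K'`).  Hence `C = 2(c + 1 + 1/V_min)`, independent of the solution and of its support.
Standard material [folklore]; the Schwarzschild fixed-mode Morawetz estimate is due to Dafermos–Rodnianski
(arXiv:0811.0354, §4.1), here with an elementary multiplier found by an exact rational search.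
-/

namespace Summit.FinalStateConjecture.FinalStateConjecture.Theorems

-- every `Summit.FinalStateConjecture.FinalStateConjecture.…` name repeats the summit = sub-problem
-- segment (D-0017 layout), as in every landed `…Theorems` file of this route
set_option linter.dupNamespace false

open MeasureTheory Set Filter Topology intervalIntegral
open Literature.Geometry.Lorentzian Literature.Geometry.Lorentzian.ReggeWheeler

noncomputable section

namespace RW
/-! ### The estimate -/

section Estimate

variable {M : ℝ} {r : ℝ → ℝ} {xc : ℝ}

/-- Dictionary: the Literature energy density of a `C²` function in Fréchet form (private copy of
`RW.energyDensity_eq_fderiv` of `…RTotalEnergyConservation`). -/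
private theorem energyDensity_eq_fderiv' {V : ℝ → ℝ} {ψ : ℝ → ℝ → ℝ}
    (hψ : ContDiff ℝ 2 (Function.uncurry ψ)) (t x : ℝ) :
    energyDensity V ψ t x = (fderiv ℝ (Function.uncurry ψ) (t, x) (1, 0)) ^ 2
      + (fderiv ℝ (Function.uncurry ψ) (t, x) (0, 1)) ^ 2 + V x * Function.uncurry ψ (t, x) ^ 2 := by
  unfold energyDensity
  rw [WaveEnergy.deriv_slice_fst_eq hψ, WaveEnergy.deriv_slice_snd_eq hψ]
  rfl

/-- Dictionary: a global solution solves the equation in Fréchet form (private copy of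
`RW.IsSolution.fderiv_eq`). -/
private theorem isSolution_fderiv_eq' {V : ℝ → ℝ} {ψ : ℝ → ℝ → ℝ} (hψ : IsSolution V ψ) :
    ∀ z : ℝ × ℝ, fderiv ℝ (fderiv ℝ (Function.uncurry ψ)) z (1, 0) (1, 0)
      - fderiv ℝ (fderiv ℝ (Function.uncurry ψ)) z (0, 1) (0, 1) + V z.2 * Function.uncurry ψ z = 0 := by
  rintro ⟨t, x⟩
  rw [← WaveEnergy.iteratedDeriv_two_slice_fst_eq hψ.1, ← WaveEnergy.iteratedDeriv_two_slice_snd_eq hψ.1]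
  exact hψ.2 (t, x)

/-- **Integrated local energy decay for a fixed Regge–Wheeler mode (Fréchet form).** For a tortoise radius
function with the photon sphere at `xc`, `s ≤ 2`, `s ≤ ℓ` and `ρ > 0` there is `C = C(M, s, ℓ, ρ, r)` such that
every global `C²` Regge–Wheeler solution with compactly supported Cauchy data satisfies
`∫_0^T ∫_{xc−ρ}^{xc+ρ} (u_t² + u_x² + u²) ≤ C · E` for all `T ≥ 0` (multiplier identity on
`[0, T] × [X_L, X_R]` for `c`·(coercive Morawetz weights) + (Lagrangian current of a bump)). [folklore] -/
theorem rwLocalEnergyDecay_fderiv (hr : IsTortoiseRadius M r xc) {s ℓ : ℕ} (hs : s ≤ 2) (hsℓ : s ≤ ℓ)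
    {ρ : ℝ} (hρ : 0 < ρ) :
    ∃ C : ℝ, 0 ≤ C ∧ ∀ ψ : ℝ → ℝ → ℝ, IsRWSolution M s ℓ r ψ →
      (∃ a b : ℝ, CauchyDataSupportedOn ψ (Icc a b)) → ∀ T : ℝ, 0 ≤ T →
        (∫ t in (0:ℝ)..T, ∫ x in (xc - ρ)..(xc + ρ),
            (fderiv ℝ (Function.uncurry ψ) (t, x) (1, 0) ^ 2
              + fderiv ℝ (Function.uncurry ψ) (t, x) (0, 1) ^ 2 + Function.uncurry ψ (t, x) ^ 2))
          ≤ C * (totalEnergy (linePotential M s ℓ r) ψ 0).toReal := by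
  -- the potential
  set V : ℝ → ℝ := linePotential M s ℓ r with hVdef
  have hVd : Differentiable ℝ V := differentiable_linePotential hr s ℓ
  have hVc : Continuous V := hVd.continuous
  have hVpos : ∀ x, 0 < V x := fun x => linePotential_pos hr hsℓ x
  have hV0 : ∀ x, 0 ≤ V x := fun x => (hVpos x).le
  -- the Morawetz weights and the bump
  obtain ⟨f, f', f'', φ, φ', m, hf, hf', hφ, hf''c, hφ'c, hmc, hmpos, hfle, hf'sq, hcoer⟩ :=
    stub_rwMorawetzWeight M r xc hr s ℓ hs hsℓ
  obtain ⟨h, h', hh, hh'c, hh01, hh1, hh0⟩ := exists_bump xc hρ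
  have hf'c : Continuous f' := (Differentiable.continuous fun x => (hf' x).differentiableAt)
  -- constants on `K' = [xc - ρ - 1, xc + ρ + 1]`
  have hK' : xc - ρ - 1 ≤ xc + ρ + 1 := by linarith
  obtain ⟨m₁, hm₁, hm₁le⟩ := exists_pos_le_on_Icc hmc hmpos hK'
  obtain ⟨V₁, hV₁, hV₁le⟩ := exists_pos_le_on_Icc hVc hVpos hK'
  obtain ⟨Hb, hHb, hHble⟩ := exists_abs_le_on_Icc hh'c (xc - ρ - 1) (xc + ρ + 1)
  obtain ⟨Vb, hVb, hVble⟩ := exists_abs_le_on_Icc hVc (xc - ρ - 1) (xc + ρ + 1)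
  obtain ⟨c, hc⟩ : ∃ c : ℝ, c = (1 + Hb + Vb + 1) / m₁ := ⟨_, rfl⟩
  have hcpos : 0 < c := by rw [hc]; positivity
  have hK : 0 ≤ c + (1 + 1 / V₁) := by positivity
  refine ⟨2 * (c + (1 + 1 / V₁)), by positivity, ?_⟩
  -- a solution with compactly supported data
  rintro ψ hψ ⟨a, b, hab⟩ T hT
  set u : ℝ × ℝ → ℝ := Function.uncurry ψ with hu_def
  have hu : ContDiff ℝ 2 u := hψ.1
  have hsol : ∀ z : ℝ × ℝ, fderiv ℝ (fderiv ℝ u) z (1, 0) (1, 0)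
      - fderiv ℝ (fderiv ℝ u) z (0, 1) (0, 1) + V z.2 * u z = 0 := isSolution_fderiv_eq' hψ
  have hud := WaveEnergy.differentiable_of_contDiff_two hu
  -- data supported in `(a', b')`, energy `E₀`
  obtain ⟨a', b', hab', ha', hb'⟩ : ∃ a' b' : ℝ, a' ≤ b' ∧ a' < a ∧ b < b' :=
    ⟨min a b - 1, max a b + 1, by linarith [min_le_max (a := a) (b := b)],
      by linarith [min_le_left a b], by linarith [le_max_right a b]⟩
  have hdata : CauchyDataSupportedOn ψ (Ioo a' b') := fun x hx =>
    hab x fun hx' => hx ⟨by linarith [hx'.1], by linarith [hx'.2]⟩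
  obtain ⟨hE0, hEeq, hEle⟩ := integral_energy_le_initial hVd hV0 hψ hab' hdata
  rw [hEeq, ENNReal.toReal_ofReal hE0]
  set E₀ : ℝ := ∫ x in a'..b', energyDensity V ψ 0 x with hE₀
  -- the rectangle `[0, T] × [XL, XR]`
  obtain ⟨XL, hXL1, hXL2⟩ : ∃ XL : ℝ, XL ≤ xc - ρ - 1 ∧ XL ≤ a' - T :=
    ⟨min (a' - T) (xc - ρ - 1), min_le_right _ _, min_le_left _ _⟩
  obtain ⟨XR, hXR1, hXR2⟩ : ∃ XR : ℝ, xc + ρ + 1 ≤ XR ∧ b' + T ≤ XR :=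
    ⟨max (b' + T) (xc + ρ + 1), le_max_right _ _, le_max_left _ _⟩
  have hXLR : XL ≤ XR := by linarith
  have hvan : ∀ t ∈ Icc 0 T, ∀ y, (y = XL ∨ y = XR) → ∀ v, u (t, y) = 0 ∧ fderiv ℝ u (t, y) v = 0 := by
    intro t ht y hy v
    have habs : |t| = t := abs_of_nonneg ht.1
    apply eq_zero_outside_cone hVd hV0 hψ hdata
    rcases hy with rfl | rfl
    · right; rw [habs]; linarith [ht.2]
    · left; rw [habs]; linarith [ht.2]
  -- the combined current: `c`·(Morawetz) + (Lagrangian with the bump)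
  have hF₁ : ∀ x, HasDerivAt (fun x => c * f x) (c * f' x) x := fun x => (hf x).const_mul c
  have hB₁ : ∀ x, HasDerivAt (fun x => c / 2 * f' x - h x) (c / 2 * f'' x - h' x) x := fun x =>
    ((hf' x).const_mul (c / 2)).sub (hh x)
  have hΦ₁ : ∀ x, HasDerivAt (fun x => c * φ x) (c * φ' x) x := fun x => (hφ x).const_mul c
  have hF₁'c : Continuous fun x => c * f' x := continuous_const.mul hf'c
  have hB₁'c : Continuous fun x => c / 2 * f'' x - h' x := (continuous_const.mul hf''c).sub hh'c
  have hΦ₁'c : Continuous fun x => c * φ' x := continuous_const.mul hφ'c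
  obtain ⟨P, hP⟩ : ∃ P : ℝ × ℝ → ℝ, ∀ t x, P (t, x) = fderiv ℝ u (t, x) (1, 0)
      * (c * f x * fderiv ℝ u (t, x) (0, 1) + (c / 2 * f' x - h x) * u (t, x)) :=
    ⟨fun z => fderiv ℝ u z (1, 0) * (c * f z.2 * fderiv ℝ u z (0, 1) + (c / 2 * f' z.2 - h z.2) * u z),
      fun t x => rfl⟩
  obtain ⟨Q, hQ⟩ : ∃ Q : ℝ × ℝ → ℝ, ∀ t x, Q (t, x)
      = 1 / 2 * (c * f x) * (fderiv ℝ u (t, x) (1, 0) ^ 2 + fderiv ℝ u (t, x) (0, 1) ^ 2)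
        + (c / 2 * f' x - h x) * (u (t, x) * fderiv ℝ u (t, x) (0, 1)) - c * φ x * u (t, x) ^ 2 :=
    ⟨fun z => 1 / 2 * (c * f z.2) * (fderiv ℝ u z (1, 0) ^ 2 + fderiv ℝ u z (0, 1) ^ 2)
        + (c / 2 * f' z.2 - h z.2) * (u z * fderiv ℝ u z (0, 1)) - c * φ z.2 * u z ^ 2,
      fun t x => rfl⟩
  obtain ⟨Bk, hBk⟩ : ∃ Bk : ℝ × ℝ → ℝ, ∀ t x, Bk (t, x)
      = (1 / 2 * (c * f' x) - (c / 2 * f' x - h x)) * fderiv ℝ u (t, x) (1, 0) ^ 2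
        + (1 / 2 * (c * f' x) + (c / 2 * f' x - h x)) * fderiv ℝ u (t, x) (0, 1) ^ 2
        + ((c / 2 * f'' x - h' x) + c * f x * V x - 2 * (c * φ x)) * (u (t, x) * fderiv ℝ u (t, x) (0, 1))
        + ((c / 2 * f' x - h x) * V x - c * φ' x) * u (t, x) ^ 2 :=
    ⟨fun z => (1 / 2 * (c * f' z.2) - (c / 2 * f' z.2 - h z.2)) * fderiv ℝ u z (1, 0) ^ 2
        + (1 / 2 * (c * f' z.2) + (c / 2 * f' z.2 - h z.2)) * fderiv ℝ u z (0, 1) ^ 2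
        + ((c / 2 * f'' z.2 - h' z.2) + c * f z.2 * V z.2 - 2 * (c * φ z.2)) * (u z * fderiv ℝ u z (0, 1))
        + ((c / 2 * f' z.2 - h z.2) * V z.2 - c * φ' z.2) * u z ^ 2,
      fun t x => rfl⟩
  have hPc : Continuous P :=
    (WaveEnergy.differentiable_multiplierP hu hF₁ hB₁ (fun z => hP z.1 z.2)).continuous
  have hBkc : Continuous Bk :=
    WaveEnergy.continuous_multiplierBulk hu hVc hF₁ hB₁ hΦ₁ hF₁'c hB₁'c hΦ₁'c (fun z => hBk z.1 z.2)
  have key := WaveEnergy.multiplier_identity_rect hu hVc hsol hF₁ hB₁ hΦ₁ hF₁'c hB₁'c hΦ₁'c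
    (fun z => hP z.1 z.2) (fun z => hQ z.1 z.2) (fun z => hBk z.1 z.2) 0 T XL XR
  -- the lateral flux vanishes
  have hQ0 : ∀ y, (y = XL ∨ y = XR) → (∫ t in (0:ℝ)..T, Q (t, y)) = 0 := by
    intro y hy
    rw [intervalIntegral.integral_congr (g := fun _ => (0 : ℝ)) (fun t ht => ?_)]
    · simp
    · rw [uIcc_of_le hT] at ht
      have h0 := hvan t ht y hy
      simp only [hQ, (h0 (1, 0)).1, (h0 (1, 0)).2, (h0 (0, 1)).2]
      ring
  rw [hQ0 XR (Or.inr rfl), hQ0 XL (Or.inl rfl), sub_zero] at key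
  -- the energy density and the comparison density `W`
  obtain ⟨e, he⟩ : ∃ e : ℝ × ℝ → ℝ, ∀ t x, e (t, x) = (fderiv ℝ u (t, x) (1, 0)) ^ 2
      + (fderiv ℝ u (t, x) (0, 1)) ^ 2 + V x * u (t, x) ^ 2 :=
    ⟨fun z => (fderiv ℝ u z (1, 0)) ^ 2 + (fderiv ℝ u z (0, 1)) ^ 2 + V z.2 * u z ^ 2, fun t x => rfl⟩
  have he' : ∀ t x, e (t, x) = energyDensity V ψ t x := fun t x => by
    rw [he, energyDensity_eq_fderiv' hu]
  have hec : Continuous e := WaveEnergy.continuous_energyDensity hu hVd (fun z => he z.1 z.2)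
  obtain ⟨W, hW⟩ : ∃ W : ℝ × ℝ → ℝ, ∀ t x, W (t, x) = h x * (fderiv ℝ u (t, x) (1, 0)) ^ 2
      + 1 / m₁ * m x * ((fderiv ℝ u (t, x) (0, 1)) ^ 2 + u (t, x) ^ 2) :=
    ⟨fun z => h z.2 * (fderiv ℝ u z (1, 0)) ^ 2 + 1 / m₁ * m z.2 * ((fderiv ℝ u z (0, 1)) ^ 2 + u z ^ 2),
      fun t x => rfl⟩
  have hoff : ∀ x, x ∉ Icc (xc - ρ - 1) (xc + ρ + 1) → h x = 0 ∧ h' x = 0 := by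
    intro x hx
    apply hh0
    rw [mem_Icc, not_and_or, not_le, not_le] at hx
    rcases hx with hx | hx
    · rw [abs_of_neg (by linarith)]; linarith
    · rw [abs_of_pos (by linarith)]; linarith
  -- pointwise: `W ≤ Bk`
  have hWBk : ∀ t x, W (t, x) ≤ Bk (t, x) := by
    intro t x
    have hQ₀ := hcoer x (fderiv ℝ u (t, x) (0, 1)) (u (t, x))
    have eBk : Bk (t, x) = c * (f' x * fderiv ℝ u (t, x) (0, 1) ^ 2
        + (1 / 2 * f'' x + f x * V x - 2 * φ x) * (u (t, x) * fderiv ℝ u (t, x) (0, 1))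
        + (1 / 2 * f' x * V x - φ' x) * u (t, x) ^ 2)
        + (h x * fderiv ℝ u (t, x) (1, 0) ^ 2 - h x * fderiv ℝ u (t, x) (0, 1) ^ 2
          - h' x * (u (t, x) * fderiv ℝ u (t, x) (0, 1)) - h x * V x * u (t, x) ^ 2) := by
      rw [hBk]; ring
    rw [eBk, hW]
    by_cases hx : x ∈ Icc (xc - ρ - 1) (xc + ρ + 1)
    · exact bulk_absorb hc hm₁ (hm₁le x hx) hHb hVb (hh01 x).1 (hh01 x).2 (hHble x hx)
        ((le_abs_self _).trans (hVble x hx)) hQ₀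
    · rw [(hoff x hx).1, (hoff x hx).2]
      have := bulk_absorb_off (p := fderiv ℝ u (t, x) (0, 1)) (q := u (t, x)) hc hm₁ hHb hVb
        (hmpos x).le hQ₀
      linarith
  -- pointwise: `0 ≤ W`, and `D ≤ W` on the strip
  have hW0 : ∀ z, 0 ≤ W z := by
    rintro ⟨t, x⟩
    rw [hW]
    have := (hh01 x).1
    have := (hmpos x).le
    positivity
  have hDW : ∀ t, ∀ x ∈ Icc (xc - ρ) (xc + ρ),
      (fderiv ℝ u (t, x) (1, 0)) ^ 2 + (fderiv ℝ u (t, x) (0, 1)) ^ 2 + u (t, x) ^ 2 ≤ W (t, x) := by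
    intro t x hx
    have hx1 : h x = 1 := hh1 x (abs_le.2 ⟨by linarith [hx.1], by linarith [hx.2]⟩)
    have hm : 1 ≤ 1 / m₁ * m x := by
      rw [one_div, ← div_eq_inv_mul, le_div_iff₀ hm₁, one_mul]
      exact hm₁le x ⟨by linarith [hx.1], by linarith [hx.2]⟩
    rw [hW, hx1]
    have h0 : 0 ≤ (fderiv ℝ u (t, x) (0, 1)) ^ 2 + u (t, x) ^ 2 := by positivity
    nlinarith
  -- pointwise: `|P| ≤ (c + 1 + 1/V₁) e`
  have hPe : ∀ t x, |P (t, x)| ≤ (c + (1 + 1 / V₁)) * e (t, x) := by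
    intro t x
    have eP : P (t, x) = c * (fderiv ℝ u (t, x) (1, 0) * (f x * fderiv ℝ u (t, x) (0, 1)
        + 1 / 2 * f' x * u (t, x))) - h x * fderiv ℝ u (t, x) (1, 0) * u (t, x) := by
      rw [hP]; ring
    have hM := morawetzP_abs_le (w := fderiv ℝ u (t, x) (1, 0)) (p := fderiv ℝ u (t, x) (0, 1))
      (q := u (t, x)) (hfle x) (hf'sq x) (hV0 x)
    have hL : |h x * fderiv ℝ u (t, x) (1, 0) * u (t, x)| ≤ (1 + 1 / V₁) * e (t, x) := by
      rw [he]
      by_cases hx : x ∈ Icc (xc - ρ - 1) (xc + ρ + 1)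
      · exact lagrangeP_abs_le hV₁ (hV₁le x hx) (hh01 x).1 (hh01 x).2
      · rw [(hoff x hx).1, zero_mul, zero_mul, abs_zero]
        have := hV0 x
        positivity
    rw [eP, add_mul]
    refine (abs_sub _ _).trans (add_le_add ?_ hL)
    rw [abs_mul, abs_of_pos hcpos, he]
    exact mul_le_mul_of_nonneg_left hM hcpos.le
  -- integrate
  have hD : Continuous fun z : ℝ × ℝ =>
      (fderiv ℝ u z (1, 0)) ^ 2 + (fderiv ℝ u z (0, 1)) ^ 2 + u z ^ 2 :=
    (((WaveEnergy.continuous_fderiv_apply hu (1, 0)).pow 2).add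
      ((WaveEnergy.continuous_fderiv_apply hu (0, 1)).pow 2)).add (hud.continuous.pow 2)
  have houter := integral2_mono_of_nonneg (p := xc - ρ) (q := xc + ρ) (XL := XL) (XR := XR) hD hBkc hT
    (by linarith) (by linarith) (by linarith)
    (fun t _ x hx => (hDW t x hx).trans (hWBk t x)) (fun z => (hW0 z).trans (hWBk z.1 z.2))
  have h0 := (abs_integral_slice_le hPc hec hK hXLR 0 (hPe 0) (by simp_rw [he']; exact hEle 0 XL XR hXLR)).1
  have h1 := (abs_integral_slice_le hPc hec hK hXLR T (hPe T) (by simp_rw [he']; exact hEle T XL XR hXLR)).2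
  linarith

end Estimate

end RW

/-- **Registered sub-goal `stub_rwLocalEnergyDecay` (ILED) of stub `stub_outgoingEnergyExhaustion` (H4)**, line
`isolated-kerr-connected-hull`, crux stmt-FinalStateConjecture-14075: integrated local energy decay on compact
tortoise intervals for every fixed Regge–Wheeler mode with compactly supported Cauchy data, with a constant
independent of the solution. [folklore] -/
theorem stub_rwLocalEnergyDecay : ∀ M : ℝ, 0 < M → ∀ (r : ℝ → ℝ) (xc : ℝ),
    ReggeWheeler.IsTortoiseRadius M r xc → ∀ (s ℓ : ℕ), s ≤ 2 → s ≤ ℓ → ∀ ρ : ℝ, 0 < ρ → ∃ C : ℝ, 0 ≤ C ∧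
      ∀ ψ : ℝ → ℝ → ℝ, ReggeWheeler.IsRWSolution M s ℓ r ψ →
        ReggeWheeler.totalEnergy (ReggeWheeler.linePotential M s ℓ r) ψ 0 < ⊤ →
        (∃ a b : ℝ, ReggeWheeler.CauchyDataSupportedOn ψ (Set.Icc a b)) → ∀ T : ℝ, 0 ≤ T →
          (∫ t in (0:ℝ)..T, ∫ x in (xc - ρ)..(xc + ρ),
              (deriv (fun τ ↦ ψ τ x) t ^ 2 + deriv (ψ t) x ^ 2 + ψ t x ^ 2))
            ≤ C * (ReggeWheeler.totalEnergy (ReggeWheeler.linePotential M s ℓ r) ψ 0).toReal := by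
  intro M _ r xc hr s ℓ hs hsℓ ρ hρ
  obtain ⟨C, hC, hmain⟩ := RW.rwLocalEnergyDecay_fderiv hr hs hsℓ hρ
  refine ⟨C, hC, fun ψ hψ _ hdata T hT => ?_⟩
  have hdict : ∀ t x, deriv (fun τ ↦ ψ τ x) t ^ 2 + deriv (ψ t) x ^ 2 + ψ t x ^ 2
      = fderiv ℝ (Function.uncurry ψ) (t, x) (1, 0) ^ 2 + fderiv ℝ (Function.uncurry ψ) (t, x) (0, 1) ^ 2
        + Function.uncurry ψ (t, x) ^ 2 := fun t x => by
    rw [WaveEnergy.deriv_slice_fst_eq hψ.1, WaveEnergy.deriv_slice_snd_eq hψ.1]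
    rfl
  simp_rw [hdict]
  exact hmain ψ hψ hdata T hT

end

end Summit.FinalStateConjecture.FinalStateConjecture.Theorems
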